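import Summits.QuantumFields.YangMills.Theses.PencilRigidity

/-!
# QuantumFields / YangMills / PencilRigidity — the assembly `Assembly`

Route `route-QuantumFields-PencilRigidity`, item stmt-QuantumFields-11691 (`Assembly`, rank 1):

  `ShellRigidity → NPointIsotropy → CurvatureKernelBound → DiagonalMirrorRPR → HypercubicLimit →
   CurvatureChannel → KernelTransfer → SpeciesProjectionPlanar → PlanarToEuclidean → YangMills`.

This is, verbatim, the curried type of the route's deciding theorem
`Summit.QuantumFields.YangMills.Theses.PencilRigidity.closes` (mass-shell pencil rigidity of the
curvature two-point kernel under the eight oriented mirror lines of the `(x₀,x₁)`-plane, the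
`n`-point planar upgrade, species bookkeeping and the `SO(4)` upgrade, composed into the
Osterwalder–Schrader package of `YangMills`), so the assembly closes by that theorem: pure logic,
no new mathematics.

References: K. Osterwalder, R. Schrader, Comm. Math. Phys. 42 (1975) 281–305;
A. Jaffe, E. Witten, *Quantum Yang–Mills theory* (Clay problem description, 2000).
-/

namespace Summit.QuantumFields.YangMills.Theorems

open Summit.QuantumFields.YangMills.Theses.PencilRigidity

/-- **Assembly of route PencilRigidity** (item stmt-QuantumFields-11691): the nine route items
`ShellRigidity`, `NPointIsotropy`, `CurvatureKernelBound`, `DiagonalMirrorRPR`, `HypercubicLimit`,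
`CurvatureChannel`, `KernelTransfer`, `SpeciesProjectionPlanar`, `PlanarToEuclidean` imply
`YangMills`. The statement is literally the type of the route's deciding theorem `closes`, which
proves it. [OsterwalderSchrader1975; JaffeWitten2000] -/
theorem pencilRigidityAssembly_proof : Assembly := by
  unfold Assembly
  exact closes

end Summit.QuantumFields.YangMills.Theorems
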